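import Literature.NumberTheory.EllipticCurves.FormalGroupLubinTateDivisionPointsDegreeOne
import Literature.NumberTheory.EllipticCurves.OrdinaryFormalGroupLubinTate
import Literature.NumberTheory.GaloisRepresentations.LubinTateTateModuleGeneratorUnique
import HarnessLib

/-!
# The uniformiser `π = e⁻¹(a − ϖ)` of the ordinary Lubin–Tate datum at a place of degree one, and the torsion points of
# `E₁` from `cohPt` with NO `ℤ_p`-side bookkeeping left (de Shalit II.1.10, II.4.4 (12) — proofs only)

Topic `NumberTheory/EllipticCurves` (theorems only; no definition, no named fact, no instance).  Sequel of
`FormalGroupLubinTateDivisionPointsDegreeOne` and `OrdinaryFormalGroupLubinTate`.  For `V/ℤ_p` with elliptic fibres and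
`a = p + 1 − #Ṽ(𝔽_p)` a unit root `ϖ` of `T² − aT + p` gives the Lubin–Tate datum `(ℤ_p, a − ϖ, p)` with `V̂ = F_{[a−ϖ]}`
(`formalGroupLaw_eq_ltF_of_root`).  At a place of degree one of a local field `F` (`e : 𝒪[F] ≃+* ℤ_p`, `#𝓀_F = p`, `p` a
uniformiser of `F` — the tree's `residueFieldCard_adicCompletion_of_padicIntEquiv`, `isUniformizer_natCast_adicCompletion_of_padicIntEquiv`
at `F = K_v`) the lane needs a uniformiser `π ∈ 𝒪[F]` with `e π = a − ϖ`:

* `natCast_eq_mul_sub_of_root` — `p = ϖ·(a − ϖ)` in `ℤ_p` (the height-one factorisation `hp` of the division-points files);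
* ★ `isUniformizer_symm_of_natCast_eq_mul` — **`π := e⁻¹(π_ℤ)` is a uniformiser of `F`** whenever `p = ϖ·π_ℤ` with `ϖ` a unit and `p`
  is a uniformiser of `F` (`π = e⁻¹(ϖ⁻¹)·p`, a unit multiple);  `isUniformizer_symm_sub_of_root` — the case `π_ℤ = a − ϖ`;
* ★★ `addOrderOf_ptOfZ_hom_one_cohPt_of_root` — II.4.4 (12) for the tree's `cohPt` with the hypotheses of the `ℤ_p`-side reduced to
  g12's (`hϖ`, `hroot`, `hP`): the point `P([1]_{P′,f} ω_{n+1}) ∈ E₁(E)` has order exactly `p^{n+1}`, for `π = e⁻¹(a − ϖ)`.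
* §4 the CONVERSE reading (feeding `LubinTateTateModuleGeneratorUnique`): `pow_nsmul_eq_zero_iff_ltSMul_hom_one_zPt` (generic: for `U ∈ E₁(K)`,
  `pⁿ • U = O ↔ [πⁿ]_g ([1]_{g,f} z(U)) = 0`), ★ `aeval_ltPolyDiv_coe_hom_one_zPt_eq_zero_of_addOrderOf` (lane layer: a point of `E₁(E)` of
  order exactly `p^{n+1}` gives a ROOT OF `φ_{n+1}` `μ := ([1]_{f,P′} z(U) : F̄)` — the hypothesis `hdiv` of `exists_unit_forall_coe_ltAct_cohPt_eq`).

Cell `bsd-print-cf2`, width seat `bsd-line-cf2c-w4` g14; no summit statement is proved; BSD is not proved by any of this.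

## References
* [deShalit1987] E. de Shalit, *Iwasawa theory of elliptic curves with complex multiplication* (1987), II §1.1, §1.10, §4.4 (12).
* [SilvermanAEC2009] J. H. Silverman, *The Arithmetic of Elliptic Curves*, 2nd ed. (2009), V.2, VII.2.2.
-/

noncomputable section

open scoped Classical
open PowerSeries

namespace Literature.NumberTheory.EllipticCurves

open ValuativeRel Literature.NumberTheory.GaloisRepresentations
  Literature.NumberTheory.GaloisRepresentations.IsNonarchimedeanLocalField
  Literature.NumberTheory.GaloisRepresentations.LubinTate
open Literature.NumberTheory.EllipticCurves.FormalGroupChart _root_.WeierstrassCurve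

/-! ## §1 `p = ϖ(a − ϖ)` -/

/-- **`p = ϖ·(a − ϖ)`** for a root `ϖ` of `T² − aT + p` (any commutative ring). [cite: deShalit1987, II §1.10] -/
theorem natCast_eq_mul_sub_of_root {R : Type*} [CommRing R] {p : ℕ} {a ϖ : R} (hroot : ϖ ^ 2 - a * ϖ + p = 0) :
    (p : R) = ϖ * (a - ϖ) := by
  linear_combination hroot

/-! ## §2 The uniformiser `e⁻¹(π_ℤ)` -/

section Uniformizer

variable {F : Type} [Field F] [ValuativeRel F] [TopologicalSpace F] [IsNonarchimedeanLocalField F]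
  {p : ℕ} [Fact p.Prime] (e : 𝒪[F] ≃+* ℤ_[p])

include e in
/-- ★ **`e⁻¹(π_ℤ)` is a uniformiser of `F`** when `p = ϖ·π_ℤ` in `ℤ_p` with `ϖ` a unit and `p` is a uniformiser of `F` (a place of degree
one): `e⁻¹(π_ℤ) = e⁻¹(ϖ⁻¹)·p`. [cite: deShalit1987, II §1.1, §1.10] -/
theorem isUniformizer_symm_of_natCast_eq_mul (h2 : (valuation F).IsUniformizer (((p : ℕ) : 𝒪[F]) : F)) {πZ ϖ : ℤ_[p]}
    (hp : (p : ℤ_[p]) = ϖ * πZ) (hϖ : IsUnit ϖ) : (valuation F).IsUniformizer ((e.symm πZ : 𝒪[F]) : F) := by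
  obtain ⟨u, rfl⟩ := hϖ
  have hπZ : πZ = ((u⁻¹ : ℤ_[p]ˣ) : ℤ_[p]) * (p : ℤ_[p]) := by
    rw [hp, ← mul_assoc, Units.inv_mul, one_mul]
  have hπ : e.symm πZ = e.symm ((u⁻¹ : ℤ_[p]ˣ) : ℤ_[p]) * ((p : ℕ) : 𝒪[F]) := by
    rw [hπZ, map_mul, map_natCast]
  have hunit : IsUnit (e.symm ((u⁻¹ : ℤ_[p]ˣ) : ℤ_[p])) := (Units.isUnit u⁻¹).map e.symm
  have hval : valuation F ((e.symm ((u⁻¹ : ℤ_[p]ˣ) : ℤ_[p]) : 𝒪[F]) : F) = 1 :=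
    (Valuation.integer.integers (valuation F)).one_of_isUnit hunit
  rw [hπ, Subring.coe_mul]
  change (valuation F).IsUniformizer (((e.symm ((u⁻¹ : ℤ_[p]ˣ) : ℤ_[p]) : 𝒪[F]) : F) * ((((p : ℕ) : 𝒪[F]) : 𝒪[F]) : F))
  rw [Valuation.IsUniformizer, map_mul, hval, one_mul]
  exact h2

include e in
/-- The case `π_ℤ = a − ϖ` of an ordinary root datum: **`e⁻¹(a − ϖ)` is a uniformiser** with `e(e⁻¹(a − ϖ)) = a − ϖ`.
[cite: deShalit1987, II §1.10] -/
theorem isUniformizer_symm_sub_of_root (h2 : (valuation F).IsUniformizer (((p : ℕ) : 𝒪[F]) : F)) {a ϖ : ℤ_[p]} (hϖ : IsUnit ϖ)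
    (hroot : ϖ ^ 2 - a * ϖ + p = 0) :
    (valuation F).IsUniformizer ((e.symm (a - ϖ) : 𝒪[F]) : F) ∧ e (e.symm (a - ϖ)) = a - ϖ :=
  ⟨isUniformizer_symm_of_natCast_eq_mul e h2 (natCast_eq_mul_sub_of_root hroot) hϖ, e.apply_symm_apply _⟩

end Uniformizer

/-! ## §3 II.4.4 (12) for `cohPt`, `ℤ_p`-side hypotheses = g12's root datum -/

section Root

variable {F : Type} [Field F] [ValuativeRel F] [TopologicalSpace F] [IsNonarchimedeanLocalField F]

attribute [local instance] ltNormUniformSpace ltNormIsUniformAddGroup rk1 nF nE fintypeResidueField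

variable {p : ℕ} [Fact p.Prime] (e : 𝒪[F] ≃+* ℤ_[p]) (hq : residueFieldCard F = p)
  (h2 : (valuation F).IsUniformizer (((p : ℕ) : 𝒪[F]) : F))
  (V : WeierstrassCurve ℤ_[p]) [hE : (V.map PadicInt.Coe.ringHom).IsElliptic] [hEt : (V.map PadicInt.toZMod).IsElliptic]
  {ϖ : ℤ_[p]} (hϖ : IsUnit ϖ)
  (hroot : ϖ ^ 2 - (Literature.NumberTheory.EllipticCurves.HasseManin.tr (V.map PadicInt.toZMod) : ℤ_[p]) * ϖ + p = 0)
  {P : ℤ_[p]⟦X⟧} (hP : P.map PadicInt.Coe.ringHom = (V.map PadicInt.Coe.ringHom).formalExp.subst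
    (C (((Literature.NumberTheory.EllipticCurves.HasseManin.tr (V.map PadicInt.toZMod) : ℤ_[p]) - ϖ : ℤ_[p]) : ℚ_[p]) *
      (V.map PadicInt.Coe.ringHom).formalLog))
  (E : IntermediateField F (AlgebraicClosure F)) [FiniteDimensional F E]
  [hEll : (curveOver E (V.map ((LTCoeff.of F).toRingHom.comp e.symm.toRingHom))).IsElliptic]

/-- ★★ **de Shalit II.4.4 (12) for the tree's generator, `ℤ_p`-side from g12's root datum**: at a place of degree one (`e`, `#𝓀_F = p`,
`p` a uniformiser), for `V/ℤ_p` with elliptic fibres, a unit root `ϖ` of `T² − aT + p` and an integral lift `P` of `[a − ϖ]`, with the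
uniformiser `π := e⁻¹(a − ϖ)` of `F`: the formal point of `[1]_{P′,f}(ω_{n+1})` (`ω_{n+1} = cohPt … n`, `f = πX + X^q`) is a point of
`E₁(E)` of order exactly `p^{n+1}`, for every finite `E ⊇ K_π^{n+1}`. [cite: deShalit1987, II §1.10, §4.4 (11)–(12)] [cite: SilvermanAEC2009, VII.2.2] -/
theorem addOrderOf_ptOfZ_hom_one_cohPt_of_root (n : ℕ)
    (h : ltField (e.symm ((Literature.NumberTheory.EllipticCurves.HasseManin.tr (V.map PadicInt.toZMod) : ℤ_[p]) - ϖ)) n ≤ E) :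
    addOrderOf (ptOfZ E (V.map ((LTCoeff.of F).toRingHom.comp e.symm.toRingHom))
        (evalPt₁ (maxNilIdeal F E)
          (hom (isLTRing_LTCoeff (isUniformizer_symm_sub_of_root e h2 hϖ hroot).1)
            (isLTSeries_map_LTCoeff_of_degree_one e hq (isUniformizer_symm_sub_of_root e h2 hϖ hroot).2
              (V.isLTSeries_of_root hϖ hroot hP))
            (isLTSeries_LTCoeff _) 1) (constantCoeff_hom _ _ _ 1)
          (inclPt h (cohPt (isUniformizer_symm_sub_of_root e h2 hϖ hroot).1 n)))) = p ^ (n + 1) :=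
  addOrderOf_ptOfZ_hom_one_cohPt (isUniformizer_symm_sub_of_root e h2 hϖ hroot).1 E e hq (isUniformizer_symm_sub_of_root e h2 hϖ hroot).2
    (isLTRing_of_root (p := p) hϖ hroot) (V.isLTSeries_of_root hϖ hroot hP) (V.formalGroupLaw_eq_ltF_of_root hϖ hroot hP)
    (natCast_eq_mul_sub_of_root hroot) hϖ n h

end Root

/-! ## §4 Converse: torsion points of `E₁` give division points of `πX + X^q` (the `hdiv` of the Tate-module uniqueness) -/

section Converse

variable {A : Type*} [CommRing A] [UniformSpace A] [DiscreteUniformity A]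
  {K : Type*} [NontriviallyNormedField K] [IsUltrametricDist K] [CompleteSpace K]
  [Algebra A (unitBall K)] [ContinuousSMul A (unitBall K)]
  {π : A} {q : ℕ} (hA : IsLTRing π q) {f g : PowerSeries A} (hf : IsLTSeries π q f) (hg : IsLTSeries π q g)
  {V : WeierstrassCurve A} (hV : V.formalGroupLaw = ltF hA hf) [hE : (curveOver K V).IsElliptic] [DecidableEq K]

include hV in
/-- **`pⁿ • U = O ↔ [πⁿ]_g ([1]_{g,f} z(U)) = 0`** for `U ∈ E₁(K)` (height one, `p = ϖπ`, `ϖ` a unit): the `p`-power torsion of the kernel of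
reduction read on the division points of any second model `g` (e.g. `πX + X^q`) through `[1]_{g,f}` (`U = P(z(U))`, `eq_ptOfZ_zPt`;
`pow_nsmul_ptOfZ_eq_zero_iff`; `ltSMul_evalPt₁_hom_one_eq_zero_iff`). [cite: deShalit1987, II §4.4 (12)] [cite: SilvermanAEC2009, VII.2.2] -/
theorem pow_nsmul_eq_zero_iff_ltSMul_hom_one_zPt {p : ℕ} {ϖ : A} (hp : (p : A) = ϖ * π) (hϖ : IsUnit ϖ) (n : ℕ)
    {U : (curveOver K V).toAffine.Point} (hU : U ∈ kernel (NormedField.valuation (K := K)) (curveOver K V)) :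
    p ^ n • U = 0 ↔
      ltSMul (ballNilIdeal K) hA hg (π ^ n) (evalPt₁ (ballNilIdeal K) (hom hA hg hf 1) (constantCoeff_hom hA hg hf 1) (zPt U hU)) = 0 := by
  rw [ltSMul_evalPt₁_hom_one_eq_zero_iff, ← pow_nsmul_ptOfZ_eq_zero_iff hA hf hV hp hϖ n, ← eq_ptOfZ_zPt hU]

include hV in
/-- From the ORDER: `addOrderOf U = p^{n+1}` gives `[π^{n+1}]_g y = 0` and `[πⁿ]_g y ≠ 0` for `y := [1]_{g,f} z(U)`.
[cite: deShalit1987, II §4.4 (iv)] -/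
theorem ltSMul_pow_hom_one_zPt_of_addOrderOf {p : ℕ} [Fact p.Prime] {ϖ : A} (hp : (p : A) = ϖ * π) (hϖ : IsUnit ϖ) {n : ℕ}
    {U : (curveOver K V).toAffine.Point} (hU : U ∈ kernel (NormedField.valuation (K := K)) (curveOver K V))
    (hord : addOrderOf U = p ^ (n + 1)) :
    ltSMul (ballNilIdeal K) hA hg (π ^ (n + 1)) (evalPt₁ (ballNilIdeal K) (hom hA hg hf 1) (constantCoeff_hom hA hg hf 1) (zPt U hU)) = 0 ∧
      ltSMul (ballNilIdeal K) hA hg (π ^ n) (evalPt₁ (ballNilIdeal K) (hom hA hg hf 1) (constantCoeff_hom hA hg hf 1) (zPt U hU)) ≠ 0 := by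
  refine ⟨(pow_nsmul_eq_zero_iff_ltSMul_hom_one_zPt hA hf hg hV hp hϖ (n + 1) hU).mp ?_, fun h => ?_⟩
  · rw [← hord]; exact addOrderOf_nsmul_eq_zero U
  · have h1 := (pow_nsmul_eq_zero_iff_ltSMul_hom_one_zPt hA hf hg hV hp hϖ n hU).mpr h
    have h2 : p ^ (n + 1) ∣ p ^ n := by rw [← hord]; exact addOrderOf_dvd_of_nsmul_eq_zero h1
    have h3 := Nat.le_of_dvd (pow_pos (Fact.out : p.Prime).pos n) h2
    have h4 : p ^ n < p ^ (n + 1) := Nat.pow_lt_pow_right (Fact.out : p.Prime).one_lt (Nat.lt_succ_self n)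
    omega

end Converse

section ConverseLane

variable {F : Type} [Field F] [ValuativeRel F] [TopologicalSpace F] [IsNonarchimedeanLocalField F]

attribute [local instance] ltNormUniformSpace ltNormIsUniformAddGroup rk1 nF nE fintypeResidueField

variable {p : ℕ} [Fact p.Prime] (e : 𝒪[F] ≃+* ℤ_[p]) (hq : residueFieldCard F = p)
  {π : 𝒪[F]} (hπ : (valuation F).IsUniformizer (π : F)) {πZ : ℤ_[p]} (he : e π = πZ)
  (hA : IsLTRing πZ p) {P : PowerSeries ℤ_[p]} (hP : IsLTSeries πZ p P)
  {V : WeierstrassCurve ℤ_[p]} (hV : V.formalGroupLaw = ltF hA hP) {ϖ : ℤ_[p]} (hp : (p : ℤ_[p]) = ϖ * πZ) (hϖ : IsUnit ϖ)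
  (E : IntermediateField F (AlgebraicClosure F)) [FiniteDimensional F E]
  [hEll : (curveOver E (V.map ((LTCoeff.of F).toRingHom.comp e.symm.toRingHom))).IsElliptic]

include hq he hV hp hϖ in
/-- ★ **A point of `E₁(E)` of order exactly `p^{n+1}` gives a root of `φ_{n+1}`**: `μ := ([1]_{f,P′} z(U) : F̄)` satisfies `φ_{n+1}(μ) = 0`
(`f = πX + X^q`) — the hypothesis `hdiv` of `exists_unit_forall_coe_ltAct_cohPt_eq` for de Shalit's points `U_n = ξ(π₀^{−n}u_n)` read at `v`.
[cite: deShalit1987, II §4.4 (12), (iv)] [cite: CasselsFrohlichANT1967, Ch. VI §3.6 Prop. 6] -/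
theorem aeval_ltPolyDiv_coe_hom_one_zPt_eq_zero_of_addOrderOf {n : ℕ}
    {U : (curveOver E (V.map ((LTCoeff.of F).toRingHom.comp e.symm.toRingHom))).toAffine.Point}
    (hU : U ∈ kernel (NormedField.valuation (K := E)) (curveOver E (V.map ((LTCoeff.of F).toRingHom.comp e.symm.toRingHom))))
    (hord : addOrderOf U = p ^ (n + 1)) :
    Polynomial.aeval ((((evalPt₁ (maxNilIdeal F E) (hom (isLTRing_LTCoeff hπ) (isLTSeries_LTCoeff π)
        (isLTSeries_map_LTCoeff_of_degree_one e hq he hP) 1) (constantCoeff_hom _ _ _ 1) (zPt U hU) : (maxNilIdeal F E).toIdeal) :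
        unitBall E) : E) : AlgebraicClosure F) ((ltPolyDiv F π n).map (algebraMap 𝒪[F] F)) = 0 := by
  have h := ltSMul_pow_hom_one_zPt_of_addOrderOf (K := E) (isLTRing_LTCoeff hπ) (isLTSeries_map_LTCoeff_of_degree_one e hq he hP)
    (isLTSeries_LTCoeff π) (formalGroupLaw_map_eq_ltF_of_degree_one e hq hπ he hA hP V hV) (natCast_eq_mul_of_degree_one e he hp)
    (isUnit_map_of_degree_one e hϖ) hU hord
  exact aeval_ltPolyDiv_coe_eq_zero_of_ltSMul_pow hπ h.1 h.2

end ConverseLane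

end Literature.NumberTheory.EllipticCurves

end
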